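import Literature.Geometry.GeometricMeasureTheory.AreaFormula
import Literature.Geometry.Kaehler.ComplexGramDeterminant
import Literature.Analysis.Complex.OsgoodProofs
import Mathlib.Analysis.InnerProductSpace.NormDet
import HarnessLib

/-!
# Wirtinger's theorem for parametrised complex submanifolds (area formula form)

Let `E`, `V` be finite-dimensional complex inner product spaces, `dim_ℂ E = p`, `U ⊆ E` open and
`F : U → V` an injective holomorphic immersion. Then for every measurable `S ⊆ U`

  `𝓗^{2p}(F(S)) = ∫_S det (⟪∂F(x) eₖ, ∂F(x) eₗ⟫_ℂ)ₖₗ d𝓗^{2p}(x)`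

for any complex orthonormal basis `e` of `E` (`euclideanHausdorffMeasure_image_eq_lintegral_det_gram_complex`,
with `𝓗^{2p} = μHE[2p]`, the Euclidean-normalised Hausdorff measure, which on `E ≅ ℂᵖ` is Lebesgue
measure), together with the change-of-variables form
`∫_{F(S)} g d𝓗^{2p} = ∫_S g(F x) det (⟪∂F(x) eₖ, ∂F(x) eₗ⟫_ℂ) d𝓗^{2p}(x)`
(`lintegral_image_eq_lintegral_mul_det_gram_complex`), the versions for `DifferentiableOn ℂ F U`
with `∂F = fderiv ℂ F` (`…_of_differentiableOn`), and the same with the integrand written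
`(normDet ∂F(x))²` for Mathlib's norm determinant (`…_normDet_sq`): the real `2p`-Jacobian of a
complex-linear map is the square of its complex Jacobian (`normDet_restrictScalars_eq_normDet_sq`).

This is Wirtinger's theorem "`vol_{2p} A = ∫_A ωᵖ/p!`, the volume of a complex `p`-dimensional
manifold is the sum of the volumes, counted with multiplicity, of its projections to the complex
coordinate `p`-planes" [Chirka1989, §14.1 Thm. and Lemma 1] in parametrised form: the integrand
`det (DF* DF)` equals `Σ_{#I=p} |det ∂F_I/∂z|²` by the Cauchy–Binet formula. It is the real area
formula [Federer1969, 3.2.3] (`Literature/Geometry/GeometricMeasureTheory/AreaFormula.lean`) for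
the realifications combined with the pointwise Wirtinger equality `J_{2p}(L) = det (⟪L eₖ, L eₗ⟫_ℂ)`
for complex-linear `L` (`Literature/Geometry/Kaehler/ComplexGramDeterminant.lean`). The real inner
product structures `InnerProductSpace.complexToReal` appear only inside the proofs: the statements
are about the metric measure `μHE[2p]` and complex Gram determinants.

Theorems only.

## References

* E. M. Chirka, *Complex Analytic Sets*, Kluwer 1989, §14.1 (Wirtinger's theorem) [Chirka1989].
* H. Federer, *Geometric Measure Theory*, Springer 1969, 3.2.3, 3.2.5 [Federer1969].
-/

open scoped ENNReal NNReal Topology InnerProductSpace ComplexOrder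
open Set Filter Function MeasureTheory MeasureTheory.Measure Module

noncomputable section

namespace Literature.Geometry.Kaehler

/-! ### The real Jacobian of a complex-linear map is the square of its complex Jacobian -/

section NormDet

variable {E V : Type*} [NormedAddCommGroup E] [InnerProductSpace ℂ E] [FiniteDimensional ℂ E]
  [NormedAddCommGroup V] [InnerProductSpace ℂ V] [FiniteDimensional ℂ V]
  {κ : Type*} [Fintype κ] [DecidableEq κ]

omit [FiniteDimensional ℂ V] in
/-- The complex Gram determinant of `L ∘ e` is the square of Mathlib's norm determinant
`L.normDet` (the complex `p`-dimensional Jacobian `|det|` of `L` onto its range):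
`Re det (⟪L eₖ, L eₗ⟫_ℂ) = L.normDet²` (Mathlib's `LinearMap.normDet_sq_eq_det_gram`).
[folklore] -/
theorem re_det_gram_complex_eq_normDet_sq (L : E →ₗ[ℂ] V) (e : OrthonormalBasis κ ℂ E) :
    ((Matrix.gram ℂ (L ∘ e)).det).re = L.normDet ^ 2 := by
  have h := L.normDet_sq_eq_det_gram e
  have h' : (Matrix.gram ℂ (L ∘ e)).det = ((L.normDet ^ 2 : ℝ) : ℂ) := h.symm
  rw [h', Complex.ofReal_re]

/-- **The real Jacobian of a complex-linear map is the square of its complex Jacobian**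
(Wirtinger's equality in terms of Mathlib's `LinearMap.normDet`): for complex-linear `L : E → V`
between finite-dimensional complex inner product spaces, the `2p`-dimensional Jacobian of the
realification `L_ℝ` (`p = dim_ℂ E`) is `normDet L_ℝ = (normDet L)²` — in coordinates, the volume
factor of the real `2n × 2p` matrix of `L` is `det (MᴴM) = |det|²`-type, the squared modulus of
the complex volume factor [Chirka1989, §14.1 Lemma 1; Federer1969, 1.8.2 and 3.2.5].
[cite: Chirka1989, §14.1 Lemma 1] -/
theorem normDet_restrictScalars_eq_normDet_sq (L : E →ₗ[ℂ] V) :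
    letI : InnerProductSpace ℝ E := InnerProductSpace.complexToReal
    letI : InnerProductSpace ℝ V := InnerProductSpace.complexToReal
    (L.restrictScalars ℝ).normDet = L.normDet ^ 2 := by
  letI : InnerProductSpace ℝ E := InnerProductSpace.complexToReal
  letI : InnerProductSpace ℝ V := InnerProductSpace.complexToReal
  set b := stdOrthonormalBasis ℝ E with hb
  set e := stdOrthonormalBasis ℂ E with he
  -- squares agree
  have h1 : ((L.restrictScalars ℝ).normDet ^ 2 : ℝ) = (Matrix.gram ℝ fun i => L (b i)).det := by
    have := (L.restrictScalars ℝ).normDet_sq_eq_det_gram b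
    simpa using this
  have h2 : (Matrix.gram ℝ fun i => L (b i)).det = (((Matrix.gram ℂ (L ∘ e)).det).re) ^ 2 :=
    det_gram_real_eq_sq_re_det_gram_complex L e b
  have h3 : ((L.restrictScalars ℝ).normDet) ^ 2 = (L.normDet ^ 2) ^ 2 := by
    rw [h1, h2, re_det_gram_complex_eq_normDet_sq]
  exact (pow_left_inj₀ (LinearMap.normDet_nonneg _) (pow_nonneg (LinearMap.normDet_nonneg _) 2)
    two_ne_zero).1 h3

end NormDet

section Wirtinger

variable {E V : Type*} [NormedAddCommGroup E] [InnerProductSpace ℂ E] [FiniteDimensional ℂ E]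
  [MeasurableSpace E] [BorelSpace E]
  [NormedAddCommGroup V] [InnerProductSpace ℂ V] [FiniteDimensional ℂ V]
  [MeasurableSpace V] [BorelSpace V]
  {κ : Type*} [Fintype κ] [DecidableEq κ]
  {F : E → V} {F' : E → E →L[ℂ] V} {U : Set E}

/-- **Wirtinger's theorem for an injective holomorphic immersion (area formula form).** Let `E`,
`V` be finite-dimensional complex inner product spaces, `dim_ℂ E = p`, `U ⊆ E` open, `F : E → V`
with complex derivative `F' x` at every `x ∈ U`, `F'` continuous on `U`, `F` injective on `U` and
every `F' x` injective. Then for every measurable `S ⊆ U` and every complex orthonormal basis `e`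
of `E`: `𝓗^{2p}(F(S)) = ∫_S det (⟪F'(x) eₖ, F'(x) eₗ⟫_ℂ)ₖₗ d𝓗^{2p}(x)`, i.e. the `2p`-volume of
the complex submanifold `F(S)` is the integral of `det (DF* DF)` — in coordinates
`Σ_{#I=p} |det ∂F_I/∂z|²`, the sum of the volumes (with multiplicity) of the projections to the
complex coordinate `p`-planes [Chirka1989, §14.1 Thm. (Wirtinger) and Lemma 1]. Here `𝓗^{2p}` is
the Euclidean-normalised Hausdorff measure `μHE[2p]` (on `E` it is Lebesgue measure). Obtained from
the real area formula
(`Literature.Geometry.GeometricMeasureTheory.euclideanHausdorffMeasure_image_eq_lintegral_sqrt_det_gram`)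
for the realifications and the identity `J_{2p}(L) = det (⟪L eₖ, L eₗ⟫_ℂ)`
(`sqrt_det_gram_real_eq_re_det_gram_complex`). [cite: Chirka1989, §14.1 Thm.] -/
theorem euclideanHausdorffMeasure_image_eq_lintegral_det_gram_complex (e : OrthonormalBasis κ ℂ E)
    (hU : IsOpen U) (hF : ∀ x ∈ U, HasFDerivAt F (F' x) x) (hF'c : ContinuousOn F' U)
    (hinj : InjOn F U) (himm : ∀ x ∈ U, Injective (F' x)) {S : Set E} (hS : MeasurableSet S)
    (hSU : S ⊆ U) :
    μHE[2 * finrank ℂ E] (F '' S) =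
      ∫⁻ x in S, ENNReal.ofReal ((Matrix.gram ℂ ((F' x : E →ₗ[ℂ] V) ∘ e)).det).re
        ∂(μHE[2 * finrank ℂ E] : Measure E) := by
  letI : InnerProductSpace ℝ E := InnerProductSpace.complexToReal
  letI : InnerProductSpace ℝ V := InnerProductSpace.complexToReal
  have hdim : finrank ℝ E = 2 * finrank ℂ E := finrank_real_of_complex E
  set b : OrthonormalBasis (Fin (finrank ℝ E)) ℝ E := stdOrthonormalBasis ℝ E with hb
  have hF_ℝ : ∀ x ∈ U, HasFDerivAt F ((F' x).restrictScalars ℝ) x := fun x hx =>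
    (hF x hx).restrictScalars ℝ
  have hF'c_ℝ : ContinuousOn (fun x => (F' x).restrictScalars ℝ) U :=
    (ContinuousLinearMap.restrictScalarsL ℂ E V ℝ ℝ).continuous.comp_continuousOn hF'c
  have himm_ℝ : ∀ x ∈ U, Injective ((F' x).restrictScalars ℝ) := fun x hx => himm x hx
  have key :=
    Literature.Geometry.GeometricMeasureTheory.euclideanHausdorffMeasure_image_eq_lintegral_sqrt_det_gram
      b hU hF_ℝ hF'c_ℝ hinj himm_ℝ hS hSU
  rw [← InnerProductSpace.euclideanHausdorffMeasure_eq_volume] at key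
  rw [← hdim, key]
  refine setLIntegral_congr_fun hS (fun x _ => ?_)
  rw [← sqrt_det_gram_real_eq_re_det_gram_complex (F' x : E →ₗ[ℂ] V) e b]
  rfl

/-- **Wirtinger's theorem, change-of-variables form**: under the hypotheses of
`euclideanHausdorffMeasure_image_eq_lintegral_det_gram_complex`, for every measurable
`g : V → [0, ∞]`,
`∫_{F(S)} g d𝓗^{2p} = ∫_S g(F x) · det (⟪F'(x) eₖ, F'(x) eₗ⟫_ℂ)ₖₗ d𝓗^{2p}(x)`.
[Chirka1989, §14.1 Thm.; Federer1969, 3.2.5] [cite: Chirka1989, §14.1 Thm.] -/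
theorem lintegral_image_eq_lintegral_mul_det_gram_complex (e : OrthonormalBasis κ ℂ E)
    (hU : IsOpen U) (hF : ∀ x ∈ U, HasFDerivAt F (F' x) x) (hF'c : ContinuousOn F' U)
    (hinj : InjOn F U) (himm : ∀ x ∈ U, Injective (F' x)) {S : Set E} (hS : MeasurableSet S)
    (hSU : S ⊆ U) {g : V → ℝ≥0∞} (hg : Measurable g) :
    ∫⁻ y in F '' S, g y ∂(μHE[2 * finrank ℂ E] : Measure V) =
      ∫⁻ x in S, g (F x) * ENNReal.ofReal ((Matrix.gram ℂ ((F' x : E →ₗ[ℂ] V) ∘ e)).det).re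
        ∂(μHE[2 * finrank ℂ E] : Measure E) := by
  letI : InnerProductSpace ℝ E := InnerProductSpace.complexToReal
  letI : InnerProductSpace ℝ V := InnerProductSpace.complexToReal
  have hdim : finrank ℝ E = 2 * finrank ℂ E := finrank_real_of_complex E
  set b : OrthonormalBasis (Fin (finrank ℝ E)) ℝ E := stdOrthonormalBasis ℝ E with hb
  have hF_ℝ : ∀ x ∈ U, HasFDerivAt F ((F' x).restrictScalars ℝ) x := fun x hx =>
    (hF x hx).restrictScalars ℝ
  have hF'c_ℝ : ContinuousOn (fun x => (F' x).restrictScalars ℝ) U :=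
    (ContinuousLinearMap.restrictScalarsL ℂ E V ℝ ℝ).continuous.comp_continuousOn hF'c
  have himm_ℝ : ∀ x ∈ U, Injective ((F' x).restrictScalars ℝ) := fun x hx => himm x hx
  have key :=
    Literature.Geometry.GeometricMeasureTheory.lintegral_image_eq_lintegral_mul_sqrt_det_gram
      b hU hF_ℝ hF'c_ℝ hinj himm_ℝ hS hSU hg
  rw [← InnerProductSpace.euclideanHausdorffMeasure_eq_volume] at key
  rw [← hdim, key]
  refine setLIntegral_congr_fun hS (fun x _ => ?_)
  rw [← sqrt_det_gram_real_eq_re_det_gram_complex (F' x : E →ₗ[ℂ] V) e b]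
  rfl

/-- **Wirtinger's theorem, `normDet` form**: `𝓗^{2p}(F(S)) = ∫_S (normDet F'(x))² d𝓗^{2p}(x)`,
the real `2p`-Jacobian of the holomorphic map being the SQUARE of its complex Jacobian
`normDet F'(x)` (Mathlib's `LinearMap.normDet`). [cite: Chirka1989, §14.1 Thm.] -/
theorem euclideanHausdorffMeasure_image_eq_lintegral_normDet_sq (hU : IsOpen U)
    (hF : ∀ x ∈ U, HasFDerivAt F (F' x) x) (hF'c : ContinuousOn F' U) (hinj : InjOn F U)
    (himm : ∀ x ∈ U, Injective (F' x)) {S : Set E} (hS : MeasurableSet S) (hSU : S ⊆ U) :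
    μHE[2 * finrank ℂ E] (F '' S) =
      ∫⁻ x in S, ENNReal.ofReal ((F' x : E →ₗ[ℂ] V).normDet ^ 2)
        ∂(μHE[2 * finrank ℂ E] : Measure E) := by
  rw [euclideanHausdorffMeasure_image_eq_lintegral_det_gram_complex (stdOrthonormalBasis ℂ E) hU hF
    hF'c hinj himm hS hSU]
  refine setLIntegral_congr_fun hS (fun x _ => ?_)
  rw [re_det_gram_complex_eq_normDet_sq]

/-- **Wirtinger's theorem, change of variables in `normDet` form**:
`∫_{F(S)} g d𝓗^{2p} = ∫_S g(F x) (normDet F'(x))² d𝓗^{2p}(x)`. [cite: Chirka1989, §14.1 Thm.] -/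
theorem lintegral_image_eq_lintegral_mul_normDet_sq (hU : IsOpen U)
    (hF : ∀ x ∈ U, HasFDerivAt F (F' x) x) (hF'c : ContinuousOn F' U) (hinj : InjOn F U)
    (himm : ∀ x ∈ U, Injective (F' x)) {S : Set E} (hS : MeasurableSet S) (hSU : S ⊆ U)
    {g : V → ℝ≥0∞} (hg : Measurable g) :
    ∫⁻ y in F '' S, g y ∂(μHE[2 * finrank ℂ E] : Measure V) =
      ∫⁻ x in S, g (F x) * ENNReal.ofReal ((F' x : E →ₗ[ℂ] V).normDet ^ 2)
        ∂(μHE[2 * finrank ℂ E] : Measure E) := by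
  rw [lintegral_image_eq_lintegral_mul_det_gram_complex (stdOrthonormalBasis ℂ E) hU hF hF'c hinj
    himm hS hSU hg]
  refine setLIntegral_congr_fun hS (fun x _ => ?_)
  rw [re_det_gram_complex_eq_normDet_sq]

/-- **Wirtinger's theorem for an injective holomorphic immersion**, `DifferentiableOn` form: if
`F` is holomorphic and injective on the open set `U` with injective differential `fderiv ℂ F x` at
every `x ∈ U`, then for every measurable `S ⊆ U` and every complex orthonormal basis `e` of `E`,
`𝓗^{2p}(F(S)) = ∫_S det (⟪∂F(x) eₖ, ∂F(x) eₗ⟫_ℂ)ₖₗ d𝓗^{2p}(x)`, `∂F = fderiv ℂ F`, `p = dim_ℂ E`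
(the derivative of a holomorphic map is continuous on `U`:
`Literature.Analysis.Complex.SCV.continuousOn_fderiv`). [cite: Chirka1989, §14.1 Thm.] -/
theorem euclideanHausdorffMeasure_image_eq_lintegral_det_gram_complex_of_differentiableOn
    (e : OrthonormalBasis κ ℂ E) (hU : IsOpen U) (hF : DifferentiableOn ℂ F U) (hinj : InjOn F U)
    (himm : ∀ x ∈ U, Injective (fderiv ℂ F x)) {S : Set E} (hS : MeasurableSet S) (hSU : S ⊆ U) :
    μHE[2 * finrank ℂ E] (F '' S) =
      ∫⁻ x in S, ENNReal.ofReal ((Matrix.gram ℂ ((fderiv ℂ F x : E →ₗ[ℂ] V) ∘ e)).det).re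
        ∂(μHE[2 * finrank ℂ E] : Measure E) :=
  euclideanHausdorffMeasure_image_eq_lintegral_det_gram_complex e hU
    (fun _ hx => (hF.differentiableAt (hU.mem_nhds hx)).hasFDerivAt)
    (Literature.Analysis.Complex.SCV.continuousOn_fderiv hF hU) hinj himm hS hSU

/-- **Wirtinger's theorem, change-of-variables form**, `DifferentiableOn` version: for holomorphic
`F` injective on the open set `U` with injective differentials, measurable `S ⊆ U` and measurable
`g : V → [0, ∞]`,
`∫_{F(S)} g d𝓗^{2p} = ∫_S g(F x) · det (⟪∂F(x) eₖ, ∂F(x) eₗ⟫_ℂ) d𝓗^{2p}(x)`.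
[cite: Chirka1989, §14.1 Thm.] -/
theorem lintegral_image_eq_lintegral_mul_det_gram_complex_of_differentiableOn
    (e : OrthonormalBasis κ ℂ E) (hU : IsOpen U) (hF : DifferentiableOn ℂ F U) (hinj : InjOn F U)
    (himm : ∀ x ∈ U, Injective (fderiv ℂ F x)) {S : Set E} (hS : MeasurableSet S) (hSU : S ⊆ U)
    {g : V → ℝ≥0∞} (hg : Measurable g) :
    ∫⁻ y in F '' S, g y ∂(μHE[2 * finrank ℂ E] : Measure V) =
      ∫⁻ x in S, g (F x) *
        ENNReal.ofReal ((Matrix.gram ℂ ((fderiv ℂ F x : E →ₗ[ℂ] V) ∘ e)).det).re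
          ∂(μHE[2 * finrank ℂ E] : Measure E) :=
  lintegral_image_eq_lintegral_mul_det_gram_complex e hU
    (fun _ hx => (hF.differentiableAt (hU.mem_nhds hx)).hasFDerivAt)
    (Literature.Analysis.Complex.SCV.continuousOn_fderiv hF hU) hinj himm hS hSU hg

/-- **An injective holomorphic map with isometric differentials preserves `2p`-volume**: if every
`F' x` is a complex-linear isometry (`⟪F' x v, F' x w⟫ = ⟪v, w⟫`), then
`𝓗^{2p}(F(S)) = 𝓗^{2p}(S)` — e.g. `F` a unitary-affine chart of a complex `p`-plane. [folklore] -/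
theorem euclideanHausdorffMeasure_image_eq_of_inner_map_map (hU : IsOpen U)
    (hF : ∀ x ∈ U, HasFDerivAt F (F' x) x) (hF'c : ContinuousOn F' U) (hinj : InjOn F U)
    (hiso : ∀ x ∈ U, ∀ v w : E, ⟪F' x v, F' x w⟫_ℂ = ⟪v, w⟫_ℂ) {S : Set E} (hS : MeasurableSet S)
    (hSU : S ⊆ U) :
    μHE[2 * finrank ℂ E] (F '' S) = (μHE[2 * finrank ℂ E] : Measure E) S := by
  have himm : ∀ x ∈ U, Injective (F' x) := by
    intro x hx v w hvw
    have h := hiso x hx (v - w) (v - w)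
    rw [map_sub, hvw, sub_self, inner_zero_left] at h
    exact sub_eq_zero.1 (inner_self_eq_zero.1 h.symm)
  rw [euclideanHausdorffMeasure_image_eq_lintegral_det_gram_complex (stdOrthonormalBasis ℂ E) hU hF
    hF'c hinj himm hS hSU]
  have h1 : ∀ x ∈ S,
      ENNReal.ofReal ((Matrix.gram ℂ ((F' x : E →ₗ[ℂ] V) ∘ (stdOrthonormalBasis ℂ E))).det).re = 1 := by
    intro x hx
    rw [gram_complex_eq_one_of_inner_map_map (F' x : E →ₗ[ℂ] V) (hiso x (hSU hx)),
      Matrix.det_one, Complex.one_re, ENNReal.ofReal_one]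
  rw [setLIntegral_congr_fun hS h1, setLIntegral_const, one_mul]

end Wirtinger

end Literature.Geometry.Kaehler

end
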